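import Mathlib
import HarnessLib
import Summits.HubbardSuperconductivity.HubbardSuperconductivity.Theorems.KLProgrammeKLRegimeEnginePairLadderRelativeStep
import Summits.HubbardSuperconductivity.HubbardSuperconductivity.Theorems.KLProgrammeKLRegimeEngineV8PairTransferRelDefs

/-!
# Route `KLProgramme` — ENGINE child gen 8 (stmt-HubbardSuperconductivity-20437 `KLRegimeEngineV17F2`), skeleton v2 class #5 «(S)-transfer» rev 3 (RELATIVE family):
# the class-#5 PRODUCER DOOR BY NAME — `pairTransferRelAt_succ` (cell gate-hubbard-kl, seat hubbard-kl-k3c1-p1 g10; plan g20 (R54f)/(R54i): door owner = this seat)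

WHY.  Rev 3 replaces «re-export by composition» (infeasible: CLASS5-DEFECT-BUDGET) by the RELATIVE induction: the clause of the pair `(ψ₁ | ψ₂)` at scale `n+1`
(`PairTransferRelAt … (n+1) Tb ψ₁ ψ₂`, `…EngineV8PairTransferRelDefs` p585429) is produced from the history pair's forward relation at scale `n` and the two
members' Wick flows along slice `n+1` by ONE door — `kltc_relative_step_fwd` (p584594), whose relative residue `Ẽ = A₁ + A₁·diag a·A₂ − A₂` obeys the linearly
dressed tangent flow with the RELATIVE source (p583555).  This file keys that door on the class-#5 names:

**`pairTransferRelAt_succ`** — per pair class `Qm` at resolution `n+1` the caller (the (c) closer) supplies, as ONE `∃`-bundle: the two Riccati flows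
`Ȧᵢ = −Aᵢ·diag ḃᵢ·Aᵢ + Sᵢ` on `[0,1]` (entrywise C¹, `|Aᵢ| ≤ m`, rates `Σ‖ḃᵢ‖ ≤ β′`, accumulated profiles `ρᵢ`, source sups `ξᵢ`), the relative weight curve `a` with
`ȧ = ḃ₁ − ḃ₂`, the ENDPOINT IDENTIFICATIONS `Aᵢ(1) = klMemberArrayF … (n+1) ψᵢ Qm` and `a(1) = −(t_{n+1}[ψ₁] − t_{n+1}[ψ₂])` (`t = klTransferWeight … (K_{n+1}) (n+1)`;
k3c1's `1 + diag a` convention vs the clause's `1 − diag t`), the HISTORY forward relation on the start arrays `(1 + diag a(0)·A₂(0))·M₀ = 1`, `‖A₁(0) − A₂(0)M₀‖ ≤ R₀`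
(the caller keys `Aᵢ(0)` to the history pair `(ψ₁ + s_{n+1} | ψ₂ + s_{n+1})` at scale `n` — across the frame shift `K_n → K_{n+1}` if the flows run at the new frame —
and `R₀` to its bar), the relative-source majorants `ξ ≥ |X_rel|`, `I ≥ ∫₀¹‖X_rel‖`, the intermediate majorants `S`, `T` of `kltc_relative_step_fwd`, the endpoint
smallness `m·Σ|a(1)| ≤ 1/3`, and ONE budget line `T + Σ_c T(x,c)‖a(1)_c‖(3m/2) ≤ Tb Qm` on the bare ball ⟹ `PairTransferRelAt L M β U μ (n+1) Tb ψ₁ ψ₂`.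
With `Tb := transferBarRelAt … (n+1) ψ₁ ψ₂` (`…EngineV8PairTransferRelBar`) the budget line is discharged slot by slot by `transferBarRelAtW_succ_room` once the
relative sources are bounded by the room (the (c) lane's per-slice input, CLASS5-DEFECT-BUDGET-2 §3).
Exact plumbing over landed lemmas; nothing about the model's sizes is asserted; nothing asserts superconductivity.  0 kit.
-/

noncomputable section

namespace Summit.HubbardSuperconductivity.HubbardSuperconductivity.Theorems.KLRegimeSplit

set_option linter.dupNamespace false -- summit = problem name (single-conjunct summit), D-0017

open Finset Matrix Set Literature.MathematicalPhysics.QuantumLattice Literature.Probability.LatticeModels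
open Summit.HubbardSuperconductivity.HubbardSuperconductivity.Theorems.KLProgrammeLegKernels
open Summit.HubbardSuperconductivity.HubbardSuperconductivity.Theorems.DispersionFlow

section Door

variable (L M : ℕ) [NeZero L] [NeZero M]

set_option maxHeartbeats 800000 in -- long hypothesis bundle; the proof is plumbing into `kltc_relative_step_fwd`
/-- **`pairTransferRelAt_succ` — the class-#5 rev-3 producer door at scale `n+1`, pair `(ψ₁ | ψ₂)`, BY NAME.**  See the module docstring for the caller's bundle. -/
theorem pairTransferRelAt_succ {β U μ : ℝ} {n : ℕ} {m : ℝ} (hm : 0 ≤ m) {ψ₁ ψ₂ : FreqMomentum L M → ℝ}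
    {Tb : TorusSite 2 L → TorusSite 2 L → TorusSite 2 L → ℝ}
    (hdata : ∀ Qm : TorusSite 2 L, IsPairClassAt L Qm (n + 1) →
      ∃ (A₁ A₁' A₂ A₂' S₁ S₂ : ℝ → Matrix (TorusSite 2 L) (TorusSite 2 L) ℂ) (b₁ b₂ b₁' b₂' a : ℝ → TorusSite 2 L → ℂ) (ρ₁ ρ₂ : TorusSite 2 L → ℝ)
        (M₀ : Matrix (TorusSite 2 L) (TorusSite 2 L) ℂ) (R₀ I S T : TorusSite 2 L → TorusSite 2 L → ℝ) (β' δ ξ ξ₁ ξ₂ : ℝ),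
        0 ≤ δ ∧ 0 ≤ ξ ∧ 0 ≤ ξ₁ ∧ 0 ≤ ξ₂ ∧
        (∀ t ∈ Icc (0 : ℝ) 1, ∀ x y, HasDerivAt (fun s => A₁ s x y) (A₁' t x y) t) ∧
        (∀ t ∈ Icc (0 : ℝ) 1, ∀ x y, HasDerivAt (fun s => A₂ s x y) (A₂' t x y) t) ∧
        (∀ t ∈ Icc (0 : ℝ) 1, ∀ c, HasDerivAt (fun s => b₁ s c) (b₁' t c) t) ∧
        (∀ t ∈ Icc (0 : ℝ) 1, ∀ c, HasDerivAt (fun s => b₂ s c) (b₂' t c) t) ∧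
        (∀ t ∈ Icc (0 : ℝ) 1, ∀ c, HasDerivAt (fun s => a s c) (b₁' t c - b₂' t c) t) ∧
        (∀ c, ContinuousOn (fun t => b₁' t c) (Icc 0 1)) ∧ (∀ c, ContinuousOn (fun t => b₂' t c) (Icc 0 1)) ∧
        (∀ x y, ContinuousOn (fun t => S₁ t x y) (Icc 0 1)) ∧ (∀ x y, ContinuousOn (fun t => S₂ t x y) (Icc 0 1)) ∧
        (∀ t ∈ Icc (0 : ℝ) 1, A₁' t = -(A₁ t * diagonal (b₁' t) * A₁ t) + S₁ t) ∧
        (∀ t ∈ Icc (0 : ℝ) 1, A₂' t = -(A₂ t * diagonal (b₂' t) * A₂ t) + S₂ t) ∧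
        (∀ t ∈ Icc (0 : ℝ) 1, ∀ x y, ‖A₁ t x y‖ ≤ m) ∧ (∀ t ∈ Icc (0 : ℝ) 1, ∀ x y, ‖A₂ t x y‖ ≤ m) ∧
        (∀ t ∈ Icc (0 : ℝ) 1, ∑ c, ‖b₁' t c‖ ≤ β') ∧ (∀ t ∈ Icc (0 : ℝ) 1, ∑ c, ‖b₂' t c‖ ≤ β') ∧
        (∀ t ∈ Icc (0 : ℝ) 1, ∀ c, ‖b₁ t c - b₁ 0 c‖ ≤ ρ₁ c) ∧ (∀ t ∈ Icc (0 : ℝ) 1, ∀ c, ‖b₂ t c - b₂ 0 c‖ ≤ ρ₂ c) ∧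
        m * β' ≤ 1 / 3 ∧ m * ∑ c, ρ₁ c ≤ 1 / 3 ∧ m * ∑ c, ρ₂ c ≤ 1 / 3 ∧
        (∀ t ∈ Icc (0 : ℝ) 1, ∀ x y, ‖S₁ t x y‖ ≤ ξ₁) ∧ (∀ t ∈ Icc (0 : ℝ) 1, ∀ x y, ‖S₂ t x y‖ ≤ ξ₂) ∧
        -- endpoint identifications at `t = 1`
        A₁ 1 = klMemberArrayF L M β U μ (n + 1) ψ₁ Qm ∧ A₂ 1 = klMemberArrayF L M β U μ (n + 1) ψ₂ Qm ∧
        (a 1 = fun p => -(((klTransferWeight L M β μ (klFlowFrameU L M β U μ (n + 1)) (n + 1) ψ₁ Qm p -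
            klTransferWeight L M β μ (klFlowFrameU L M β U μ (n + 1)) (n + 1) ψ₂ Qm p : ℝ)) : ℂ)) ∧
        -- history forward relation at `t = 0`
        (1 + diagonal (a 0) * A₂ 0) * M₀ = 1 ∧ (∀ x y, ‖(A₁ 0 - A₂ 0 * M₀) x y‖ ≤ R₀ x y) ∧
        (∀ x y, R₀ x y + ∑ c, R₀ x c * ‖a 0 c‖ * m ≤ δ) ∧
        -- relative source majorants, intermediate majorants, endpoint smallness
        (∀ t ∈ Icc (0 : ℝ) 1, ∀ x y, ‖(S₁ t * (1 + diagonal (a t) * A₂ t) + A₁ t * diagonal (a t) * S₂ t - S₂ t) x y‖ ≤ ξ) ∧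
        (∀ x y, (∫ t in (0 : ℝ)..1, ‖(S₁ t * (1 + diagonal (a t) * A₂ t) + A₁ t * diagonal (a t) * S₂ t - S₂ t) x y‖) ≤ I x y) ∧
        (∀ x y, (R₀ x y + ∑ c, R₀ x c * ‖a 0 c‖ * m) +
            (I x y + ∑ c, I x c * ρ₂ c * m + ∑ a', m * ρ₁ a' * I a' y + ∑ a', ∑ c, m * ρ₁ a' * I a' c * ρ₂ c * m) +
            4 / 3 * (δ * Real.exp (m * β' + m * β') + 2 * ξ) * β' * (8 / 3 * ξ₁ + 8 / 3 * ξ₂) ≤ S x y) ∧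
        (∀ x y, S x y + ∑ c, S x c * ρ₂ c * (3 / 2 * m) + ∑ a', 3 / 2 * m * ρ₁ a' * S a' y +
            ∑ a', ∑ c, 3 / 2 * m * ρ₁ a' * S a' c * ρ₂ c * (3 / 2 * m) ≤ T x y) ∧
        m * ∑ c, ‖a 1 c‖ ≤ 1 / 3 ∧
        -- the budget line on the bare ball
        (∀ k ∈ klBall L μ 0, ∀ k' ∈ klBall L μ 0, T k k' + ∑ c, T k c * ‖a 1 c‖ * (3 / 2 * m) ≤ Tb Qm k k')) :
    PairTransferRelAt L M β U μ (n + 1) Tb ψ₁ ψ₂ := by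
  intro Qm hQm
  obtain ⟨A₁, A₁', A₂, A₂', S₁, S₂, b₁, b₂, b₁', b₂', a, ρ₁, ρ₂, M₀, R₀, I, S, T, β', δ, ξ, ξ₁, ξ₂, hδ, hξ, hξ₁, hξ₂, hA₁, hA₂, hb₁, hb₂, ha, hb₁'c, hb₂'c,
    hS₁c, hS₂c, hflow₁, hflow₂, hA₁m, hA₂m, hβ₁, hβ₂, hρ₁, hρ₂, hmβ, hZ₁, hZ₂, hS₁, hS₂, hA₁1, hA₂1, ha1, hM₀, hR₀, hR₀δ, hXξ, hI, hS, hT, hsm₁,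
    hbud⟩ := hdata Qm hQm
  obtain ⟨N, h1, h2, hbd⟩ := kltc_relative_step_fwd A₁ A₁' A₂ A₂' S₁ S₂ b₁ b₂ b₁' b₂' a ρ₁ ρ₂ M₀ R₀ I S T hm hδ hξ hξ₁ hξ₂ hA₁ hA₂ hb₁ hb₂ ha hb₁'c
    hb₂'c hS₁c hS₂c hflow₁ hflow₂ hA₁m hA₂m hβ₁ hβ₂ hρ₁ hρ₂ hmβ hZ₁ hZ₂ hS₁ hS₂ hM₀ hR₀ hR₀δ hXξ hI hS hT hsm₁
  -- re-key `1 + diag a(1)·A₂(1)` as `1 − diag(t₁ − t₂)·A°[ψ₂]`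
  have hkey : 1 + diagonal (a 1) * A₂ 1 =
      1 - diagonal (fun p => ((klTransferWeight L M β μ (klFlowFrameU L M β U μ (n + 1)) (n + 1) ψ₁ Qm p -
          klTransferWeight L M β μ (klFlowFrameU L M β U μ (n + 1)) (n + 1) ψ₂ Qm p : ℝ) : ℂ)) * klMemberArrayF L M β U μ (n + 1) ψ₂ Qm := by
    rw [ha1, hA₂1]
    have hd : diagonal (fun p => -(((klTransferWeight L M β μ (klFlowFrameU L M β U μ (n + 1)) (n + 1) ψ₁ Qm p -
        klTransferWeight L M β μ (klFlowFrameU L M β U μ (n + 1)) (n + 1) ψ₂ Qm p : ℝ)) : ℂ)) =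
        -diagonal (fun p => ((klTransferWeight L M β μ (klFlowFrameU L M β U μ (n + 1)) (n + 1) ψ₁ Qm p -
          klTransferWeight L M β μ (klFlowFrameU L M β U μ (n + 1)) (n + 1) ψ₂ Qm p : ℝ) : ℂ)) := by
      rw [← diagonal_neg]
    rw [hd, neg_mul, sub_eq_add_neg]
  refine ⟨N, ?_, ?_, fun k hk k' hk' => ?_⟩
  · rw [← hkey]; exact h1
  · rw [← hkey]; exact h2
  · have hb := hbd k k'
    rw [hA₁1, hA₂1] at hb
    exact hb.trans (hbud k hk k' hk')

end Door

end Summit.HubbardSuperconductivity.HubbardSuperconductivity.Theorems.KLRegimeSplit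

end
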